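/-
ι₁∕Id CHAIN TWIN (ASSEMBLER g3 TABLE v1.2 row I7, pen prove-3 g3; «WORLD = C» l.12481 (4)): ✔ p372482 by TOKEN FLIP + §5. ORIGINAL HEADER:
COR-CM (cell pub-hodgecm2, stage 2 of the Hodge ladder) — Δ2 BRIDGE, VERSION-B item (1)(d) «THE PIECES AT THE PIN» (coordinator pairing
prove-3 + prove-8; ASSEMBLER DECISIONS #8 / #11, HOME/INBOX l. 11019 / l. 11226): the `pieces` binder of the LANDED pin-form assembly
`PinSignatures.thm418C_liuDictionaryPin_of_pins` (✔ p370763) — `HcmPieces (toThm418Data C (U.rest (restTailOne …))) (M i …) T.H (jH i …) K.K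
(H¹(P_K; ℂ)) (resTotal K) (T.cmClasses K i)` for EVERY good index `i` and EVERY level `K` below the threshold `Ks := Level.capThree K₀` — COMPOSED
from the four owners' tree∕desk theorems: prove-8's generic `nonempty_hcmPieces_ofTower` (✔ p369968), prove-2's J-record pin `map43RecordAtPin ∕
levelwisePin ∕ jHPin ∕ resTotal_ιT_tmul_transKQ` (`Map43RecordAtPin[Levels].lean`), prove-1's S1 junction `exists_dLiu_of_objOne` (✔ p370055), and
this seat's S3∕S4 junction below the threshold (§1–§3).  Seat prover-pub-hodgecm2-d2bridge-prove-3-g2-0 (d2bridge-prove-3).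
THEOREMS ONLY (kernel lane); no definition, no instance, no named fact, no `sorry`; nothing landed is edited or restated; OUTSIDE the port
manifest.  FRAMING: HC_CM is NOT proved; «Δ2 BRIDGE CLOSED» is NOT claimed; hLiu at the constructed objects is a READING (r8) until every pin
is a theorem and the referee signs; no pointer ∕ count ∕ hM token.
-/
import Summits.HodgeConjecture.CorCM.D2Bridge.Iota1.Map43RecordAtPin
import Summits.HodgeConjecture.CorCM.D2Bridge.HcmPiecesAtTowerAnyDatum
import Summits.HodgeConjecture.CorCM.D2Bridge.HcmS1PinJunction
import Summits.HodgeConjecture.HodgeCM.Model.LiuDictionaryPin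
import Summits.HodgeConjecture.HodgeCM.Model.AdelicThetaDistributionSat_1
import Literature.NumberTheory.Automorphic.Liu2021.AppendixC.Prop413DataOfRestOne
import HarnessLib

set_option autoImplicit false

/-!
# Δ2 bridge, pieces pin (d) over the UNTWISTED datum (ι₁ ∕ Id chain): the `HcmPieces` record AT THE PIN

Id-chain twin of `CorCM/D2Bridge/HcmPiecesAtPin.lean` (✔ p372482, whose module docstring applies verbatim with `ComponentAlbanese ↦
ComponentAlbaneseId`, `Model.honestP5Of ↦ Model.honestP5IdOf`): §1 threshold, §2 level agreement, §3 the S3∕S4 junction, §4 the compositions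
(presentation embedding `ιg`, `hinst : algebraMap = ιg`, X3-Char `hadmμ` displayed); NEW §5 `nonempty_hcmPieces_atLiuDictionaryPin_of_cmType_eq`:
over the untwisted datum the J2 interface lives at the instance `ι₁` itself (cofan along `ι₁`), so `ιg := ι₁` and X3-Char is discharged from
`hsign : hμ.cmType = typeOfLine (line i)` — instance = tail = key = ι₁.  [Liu2021] Thm. 4.18 (1) and its proof l. 2247–2253, Rem. 4.17,
Lem. 2.4 (1), Def. 4.5 (2), Prop. 4.6 (1), §4.2, Prop. C.5.  Nothing asserted about Liu's objects; HC_CM is NOT proved; «Δ2 BRIDGE CLOSED» NOT claimed.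
-/

noncomputable section

open scoped TensorProduct
open CategoryTheory NumberField Function
open Literature.AlgebraicGeometry.Motives (AbelianVariety bettiCohomology)
open Literature.AlgebraicGeometry.HodgeTheory
open Literature.AlgebraicGeometry.ShimuraVarieties.UnitaryCanonicalModel (exists_recordSystem)
open Literature.NumberTheory.Automorphic Literature.NumberTheory.Automorphic.Liu2021 Literature.NumberTheory.Automorphic.Liu2021.AppendixC
open Literature.NumberTheory.Automorphic.Liu2021.AppendixC.RestOne
open Literature.NumberTheory.Automorphic.PicardCM
open Literature.NumberTheory.Transcendental (Arapura2012_Cor_15_4_6)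
open HodgeCM HodgeCM.Model HodgeCM.Model.LevelTranslate HodgeCM.Model.TowerLevel HodgeCM.Model.TowerCarrier
open Summit.HodgeConjecture.CorCM.D2Bridge.TowerRational

namespace Summit.HodgeConjecture.CorCM.D2Bridge.Iota1

section S3Junctions

-- NB (gate routing): the universe's standing rows `hHD ∕ hI ∕ hU ∕ h₃ ∕ hA ∕ h` and everything typed over them are PER-THEOREM
-- binders in this file (never section `variable`s), so that the file verifies in the kernel lane.
variable {L : HodgeCM.CMField} {ι₁ : L →+* ℂ}
variable {V : HodgeCM.HermSpace3 L ι₁} {Φ : Literature.AlgebraicGeometry.Motives.CMType L} {isotropicAt : ℕ → Prop} [Algebra L ℂ]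

/-! ## §1  The threshold `Level.capThree K₀` -/

section Threshold

omit [Algebra L ℂ] in
/-- **Below the threshold the compact open lies inside App. C's `K₀`**: `K ≤ Level.capThree K₀ _ → K.K ⊆ K₀` («sufficiently small»,
[Liu2021] Thm. 4.18 (1) l. 2239 ∕ Prop. C.5 l. 4627–4628). [cite: Liu2021, Thm. 4.18 (1) (FJcycle.tex l. 2239)] -/
theorem K_le_K₀_of_le_capThree {h : exists_recordSystem}
    (C : Sec42Data (Model.honestP5IdOf h ⟨L.K⟩ ι₁ ⟨V.Hm, V.isHermitian, V.signature_ι₁, V.posDef_of_ne⟩ Φ) isotropicAt) {K : HodgeCM.Level V}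
    (hK : K ≤ Level.capThree (V := V) (C.S.K₀.1 : Subgroup ↥V.adelicFin) C.S.K₀.2.1) :
    (K.K : Subgroup ↥V.adelicFin) ≤ (C.S.K₀.1 : Subgroup ↥V.adelicFin) :=
  fun _ hx => HodgeCM.Level.capThree_K_le (V := V) (C.S.K₀.1 : Subgroup ↥V.adelicFin) C.S.K₀.2.1 (HodgeCM.Level.le_def.mp hK hx)

omit [Algebra L ℂ] in
/-- **Below the threshold a level lies below a conjugate of `K_f(3)`** (the tower's component bookkeeping hypothesis). [folklore] -/
theorem belowConjThree_of_le_capThree {h : exists_recordSystem}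
    (C : Sec42Data (Model.honestP5IdOf h ⟨L.K⟩ ι₁ ⟨V.Hm, V.isHermitian, V.signature_ι₁, V.posDef_of_ne⟩ Φ) isotropicAt) {K : HodgeCM.Level V}
    (hK : K ≤ Level.capThree (V := V) (C.S.K₀.1 : Subgroup ↥V.adelicFin) C.S.K₀.2.1) : K.BelowConjThree :=
  HodgeCM.Level.belowConjThree_of_le_three (hK.trans (HodgeCM.Level.capThree_le_three _ _))

omit [Algebra L ℂ] in
/-- The compact open of a model level is open compact in [Liu2021]'s sense (`IsOpenCompact`). [cite: Liu2021, §4.2 (FJcycle.tex l. 2060)] -/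
theorem isOpenCompact_levelK {h : exists_recordSystem}
    {C : Sec42Data (Model.honestP5IdOf h ⟨L.K⟩ ι₁ ⟨V.Hm, V.isHermitian, V.signature_ι₁, V.posDef_of_ne⟩ Φ) isotropicAt} (K : HodgeCM.Level V) :
    IsOpenCompact (G := C.G) (K.K : Subgroup ↥V.adelicFin) :=
  ⟨K.isOpen_K, K.isCompact_K⟩

omit [Algebra L ℂ] in
/-- **Below the threshold App. C's level of `K.K` IS `K.K`**: `(C.levelOf K.K : Subgroup) = K.K` (`Sec42Data.coe_levelOf`).
[cite: Liu2021, Thm. 4.18 (1) (FJcycle.tex l. 2239)] -/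
theorem coe_levelOf_levelK {h : exists_recordSystem}
    (C : Sec42Data (Model.honestP5IdOf h ⟨L.K⟩ ι₁ ⟨V.Hm, V.isHermitian, V.signature_ι₁, V.posDef_of_ne⟩ Φ) isotropicAt) {K : HodgeCM.Level V}
    (hK : K ≤ Level.capThree (V := V) (C.S.K₀.1 : Subgroup ↥V.adelicFin) C.S.K₀.2.1) :
    ((C.levelOf (K.K : Subgroup ↥V.adelicFin)).1 : Subgroup C.G) = (K.K : Subgroup ↥V.adelicFin) :=
  C.coe_levelOf (isOpenCompact_levelK (C := C) K) (K_le_K₀_of_le_capThree C hK)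

end Threshold

/-! ## §2  The level agreement `J.Γof (C.levelOf K.K) = K` and the translation condition -/

section LevelAgreement

/-- **Level agreement from the HONEST dictionary law** `(J.Γof K₁).K = K₁`: below the threshold `J.Γof (C.levelOf K.K) = K`
(a model level is determined by its compact open, `Level.ext`). [folklore] -/
theorem ComponentAlbaneseId.Γof_levelOf_eq_of_K_eq {hHD : exists_isReal_hodgeModel} {hI : hodgePQ_independent_of_hodgeModel}
    {hU : BallQuotientUniformisedDatum} {h₃ : CMAbelianVarietyRealised} {hA : Arapura2012_Cor_15_4_6} {h : exists_recordSystem}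
    {C : Sec42Data (Model.honestP5IdOf h ⟨L.K⟩ ι₁ ⟨V.Hm, V.isHermitian, V.signature_ι₁, V.posDef_of_ne⟩ Φ) isotropicAt}
    {T : C.HeckeTranslates} (J : ComponentAlbaneseId hHD hI hU h₃ hA V h Φ C T)
    {K : HodgeCM.Level V}
    (hK : K ≤ Level.capThree (V := V) (C.S.K₀.1 : Subgroup ↥V.adelicFin) C.S.K₀.2.1)
    (hΓ : ∀ K₁ : C5.SmallLevel C.S.K₀, ((J.Γof K₁).K : Subgroup ↥V.adelicFin) = (K₁.1 : Subgroup C.G)) :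
    J.Γof (C.levelOf (K.K : Subgroup ↥V.adelicFin)) = K :=
  HodgeCM.Level.ext (((hΓ (C.levelOf (K.K : Subgroup ↥V.adelicFin))).trans (coe_levelOf_levelK C hK)))

/-- **The translation condition of the junction**: if `J.Γof K₁ = K` then `t_1 : P_K ⟶ P_{(Γof K₁)_1}` is defined
(`TransCond 1 K ((J.Γof K₁).conj 1)`, as `(Γof K₁).conj 1 = Γof K₁ = K`). [folklore] -/
theorem ComponentAlbaneseId.transCond_one_of_Γof_eq {hHD : exists_isReal_hodgeModel} {hI : hodgePQ_independent_of_hodgeModel}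
    {hU : BallQuotientUniformisedDatum} {h₃ : CMAbelianVarietyRealised} {hA : Arapura2012_Cor_15_4_6} {h : exists_recordSystem}
    {C : Sec42Data (Model.honestP5IdOf h ⟨L.K⟩ ι₁ ⟨V.Hm, V.isHermitian, V.signature_ι₁, V.posDef_of_ne⟩ Φ) isotropicAt}
    {T : C.HeckeTranslates} (J : ComponentAlbaneseId hHD hI hU h₃ hA V h Φ C T)
    {K₁ : C5.SmallLevel C.S.K₀} {K : HodgeCM.Level V} (e : J.Γof K₁ = K) :
    TransCond ((1 : ↥(Urat V)) : GL (Fin 3) L) K ((J.Γof K₁).conj 1 (J.belowConjThree K₁)) :=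
  transCond_one_of_eq (by rw [HodgeCM.Level.conj_one, e])

end LevelAgreement

/-! ## §3  The junction `hj` below the threshold -/

section Junction

/-- **The S3 junction on ALL of `ℂ ⊗_ℚ H¹_B((A_{K₁} ⊗ ℂ)(ℂ); ℚ)`**, `K₁ := C.levelOf K.K`: restricting the transported class
`(ιT ∘ (ofQ Γ_{K₁} ∘ albStarQ K₁) ⊗ ℂ) y` (the S2 field term `transK` of the J-record pin) to the identity component `P_K` is pulling `y` back
along `t_1 ≫ alb K₁ 1 : P_K ⟶ P_{(Γof K₁)_1} ⟶ A_{K₁} ⊗ ℂ` — d2bridge-prove-2's pure-tensor law `resTotal_ιT_tmul_transKQ` extended by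
linearity.  With it the S3 fields of `HcmPieces` are `XK := AK`, `albK := LinearEquiv.refl`, `resX := ((t_1 ≫ alb K₁ 1)^*) ⊗ ℂ`.
[cite: Liu2021, Lemma 2.4 (1) with proof (FJcycle.tex l. 1210–1228); §4.2 (l. 2066–2072)] -/
theorem ComponentAlbaneseId.resTotal_ιT_baseChange_transKQ {hHD : exists_isReal_hodgeModel} {hI : hodgePQ_independent_of_hodgeModel}
    {hU : BallQuotientUniformisedDatum} {h₃ : CMAbelianVarietyRealised} {hA : Arapura2012_Cor_15_4_6} {h : exists_recordSystem}
    {C : Sec42Data (Model.honestP5IdOf h ⟨L.K⟩ ι₁ ⟨V.Hm, V.isHermitian, V.signature_ι₁, V.posDef_of_ne⟩ Φ) isotropicAt}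
    {T : C.HeckeTranslates} (J : ComponentAlbaneseId hHD hI hU h₃ hA V h Φ C T)
    {K : HodgeCM.Level V}
    (e : J.Γof (C.levelOf (K.K : Subgroup ↥V.adelicFin)) = K)
    (ht : TransCond ((1 : ↥(Urat V)) : GL (Fin 3) L) K
      ((J.Γof (C.levelOf (K.K : Subgroup ↥V.adelicFin))).conj 1 (J.belowConjThree _)))
    (y : ℂ ⊗[ℚ] bettiCohomology ((C.A (C.levelOf (K.K : Subgroup ↥V.adelicFin))).baseChange ℂ).X 1) :
    resTotal hHD hI hU h₃ hA K
        ((ιT hHD hI hU h₃ hA V ∘ₗ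
            (ofQ hHD hI hU h₃ hA (J.Γof (C.levelOf (K.K : Subgroup ↥V.adelicFin))) (J.belowConjThree _) ∘ₗ
              J.albStarQ (C.levelOf (K.K : Subgroup ↥V.adelicFin))).baseChange ℂ) y) =
      (BettiUniverse.pull
          (transMorU hU h₃ hHD hI hA (1 : ↥(Urat V)).2 K
              ((J.Γof (C.levelOf (K.K : Subgroup ↥V.adelicFin))).conj 1 (J.belowConjThree _)) ht ≫
            J.alb (C.levelOf (K.K : Subgroup ↥V.adelicFin)) 1) 1).baseChange ℂ y := by
  induction y using TensorProduct.induction_on with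
  | zero =>
    rw [map_zero, map_zero, map_zero]
    rfl
  | tmul z x =>
    rw [LinearMap.baseChange_tmul, ← resTotal_ιT_tmul_transKQ J e ht z x, LinearMap.comp_apply, LinearMap.baseChange_tmul,
      LinearMap.comp_apply]
  | add s t hs ht' =>
    rw [map_add, map_add, map_add, hs, ht']
    rfl

variable {Lg : Type} [Field Lg] [NumberField Lg] [IsGalois ℚ Lg] (emb : L →ₐ[ℚ] Lg) (ιg : Lg →+* ℂ)
  {μ : Literature.NumberTheory.Automorphic.IdeleClassGroup L →ₜ* Circle}
  (hμ : Literature.NumberTheory.Automorphic.IdeleClassGroup.IsConjugateSymplectic L μ)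
  (hw : Literature.NumberTheory.Automorphic.IdeleClassGroup.HasWeight L μ 1) (Car : Def45.Carriers L μ)
  (Eps : Type) (epsOf : L → Eps) (Chi : Type) (omega : Eps → Chi → Type)
  [∀ ε χ, AddCommGroup (omega ε χ)] [∀ ε χ, Module ℂ (omega ε χ)]

/-- **`hj` LITERALLY, on pure tensors** — the binder `hj` of `nonempty_hcmPieces_ofTower` (`HcmPiecesAtTower.lean`, d2bridge-prove-8) at the
J-record pin `M := map43RecordAtPin …` (`M.ι = ιT`), `Λ := levelwisePin …` (`Λ.transKQ K₁ = ofQ Γ_{K₁} ∘ albStarQ K₁`), `jH := jHPin … = id`: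
`resTotal K (jH (M.ι ((Λ.transKQ K₁).baseChange ℂ (z ⊗ x)))) = z ⊗ rj x` with `rj := (t_1 ≫ alb K₁ 1)^*`, `K₁ := C.levelOf K.K`
(prove-2's `resTotal_ιT_tmul_transKQ`, the definitions unfolded). [cite: Liu2021, Lemma 2.4 (1) with proof (FJcycle.tex l. 1210–1228); proof of Thm. 4.18 (l. 2247–2253)] -/
theorem ComponentAlbaneseId.resTotal_ι_transKQ_tmul {hHD : exists_isReal_hodgeModel} {hI : hodgePQ_independent_of_hodgeModel}
    {hU : BallQuotientUniformisedDatum} {h₃ : CMAbelianVarietyRealised} {hA : Arapura2012_Cor_15_4_6} {h : exists_recordSystem}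
    {C : Sec42Data (Model.honestP5IdOf h ⟨L.K⟩ ι₁ ⟨V.Hm, V.isHermitian, V.signature_ι₁, V.posDef_of_ne⟩ Φ) isotropicAt}
    {T : C.HeckeTranslates} (J : ComponentAlbaneseId hHD hI hU h₃ hA V h Φ C T)
    (rho : ∀ ε χ, Representation ℂ C.G (omega ε χ))
    (Dμ : ObjOne emb ιg hμ hw Car) (τ' : L →+* ℂ) (hτ' : τ' ∈ hμ.cmType.1)
    {K : HodgeCM.Level V}
    (e : J.Γof (C.levelOf (K.K : Subgroup ↥V.adelicFin)) = K)
    (ht : TransCond ((1 : ↥(Urat V)) : GL (Fin 3) L) K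
      ((J.Γof (C.levelOf (K.K : Subgroup ↥V.adelicFin))).conj 1 (J.belowConjThree _)))
    (z : ℂ) (x : bettiCohomology ((C.A (C.levelOf (K.K : Subgroup ↥V.adelicFin))).baseChange ℂ).X 1) :
    resTotal hHD hI hU h₃ hA K
        (jHPin J emb ιg hμ hw Car Eps epsOf Chi omega rho Dμ τ' hτ'
          ((map43RecordAtPin J emb ιg hμ hw Car Eps epsOf Chi omega rho Dμ τ' hτ').ι
            (((levelwisePin J emb ιg hμ hw Car Dμ).transKQ (C.levelOf (K.K : Subgroup ↥V.adelicFin))).baseChange ℂ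
              (z ⊗ₜ[ℚ] x)))) =
      z ⊗ₜ[ℚ] BettiUniverse.pull
          (transMorU hU h₃ hHD hI hA (1 : ↥(Urat V)).2 K
              ((J.Γof (C.levelOf (K.K : Subgroup ↥V.adelicFin))).conj 1 (J.belowConjThree _)) ht ≫
            J.alb (C.levelOf (K.K : Subgroup ↥V.adelicFin)) 1) 1 x := by
  rw [← resTotal_ιT_tmul_transKQ J e ht z x]
  show resTotal hHD hI hU h₃ hA K (ιT hHD hI hU h₃ hA V
    ((ofQ hHD hI hU h₃ hA _ _ ∘ₗ J.albStarQ _).baseChange ℂ (z ⊗ₜ[ℚ] x))) = _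
  rw [LinearMap.baseChange_tmul, LinearMap.comp_apply]

/-- **The S4 junction `hrj` at the J-record pin** — the binder `hrj` of `nonempty_hcmPieces_ofTower` with `rj := (t_1 ≫ alb K₁ 1)^*`,
`jf f := t_1 ≫ alb K₁ 1 ≫ f_ℂ`, `α₀ := α`: `(rj ∘ (f ⊗ ℂ)^*) ⊗ ℂ · α = ((t_1 ≫ alb K₁ 1 ≫ f_ℂ)^*) ⊗ ℂ · α` — functoriality of `H¹`
(`BettiUniverse.pull_comp`; `(levelwisePin …).phiStarQ K₁ f = (f ⊗ ℂ)^*` by `rfl`). [cite: Liu2021, proof of Thm. 4.18 (FJcycle.tex l. 2247–2253); Lemma 2.4 (1) proof (l. 1220–1228)] -/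
theorem ComponentAlbaneseId.rj_comp_phiStarQ_baseChange {hHD : exists_isReal_hodgeModel} {hI : hodgePQ_independent_of_hodgeModel}
    {hU : BallQuotientUniformisedDatum} {h₃ : CMAbelianVarietyRealised} {hA : Arapura2012_Cor_15_4_6} {h : exists_recordSystem}
    {C : Sec42Data (Model.honestP5IdOf h ⟨L.K⟩ ι₁ ⟨V.Hm, V.isHermitian, V.signature_ι₁, V.posDef_of_ne⟩ Φ) isotropicAt}
    {T : C.HeckeTranslates} (J : ComponentAlbaneseId hHD hI hU h₃ hA V h Φ C T)
    (Dμ : ObjOne emb ιg hμ hw Car) {K : HodgeCM.Level V}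
    (ht : TransCond ((1 : ↥(Urat V)) : GL (Fin 3) L) K
      ((J.Γof (C.levelOf (K.K : Subgroup ↥V.adelicFin))).conj 1 (J.belowConjThree _)))
    (f : C.A (C.levelOf (K.K : Subgroup ↥V.adelicFin)) ⟶ AμOne emb ιg hμ hw Car Dμ)
    (α : ℂ ⊗[ℚ] bettiCohomology ((AμOne emb ιg hμ hw Car Dμ).baseChange ℂ).X 1) :
    (BettiUniverse.pull
          (transMorU hU h₃ hHD hI hA (1 : ↥(Urat V)).2 K
              ((J.Γof (C.levelOf (K.K : Subgroup ↥V.adelicFin))).conj 1 (J.belowConjThree _)) ht ≫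
            J.alb (C.levelOf (K.K : Subgroup ↥V.adelicFin)) 1) 1 ∘ₗ
        (levelwisePin J emb ιg hμ hw Car Dμ).phiStarQ (C.levelOf (K.K : Subgroup ↥V.adelicFin)) f).baseChange ℂ α =
      (BettiUniverse.pull
          (transMorU hU h₃ hHD hI hA (1 : ↥(Urat V)).2 K
              ((J.Γof (C.levelOf (K.K : Subgroup ↥V.adelicFin))).conj 1 (J.belowConjThree _)) ht ≫
            J.alb (C.levelOf (K.K : Subgroup ↥V.adelicFin)) 1 ≫ (AbelianVariety.Hom.baseChange ℂ f).hom.hom.hom) 1).baseChange ℂ α := by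
  rw [levelwisePin_phiStarQ, ← BettiUniverse.pull_comp, Category.assoc]

end Junction

end S3Junctions

/-! ## §4  The compositions: the pieces at the J-record pin, at the DECISION #8 type, at the literal pin -/

section Compositions

open Literature.AlgebraicGeometry.Motives (SchemeOver)
open HodgeCM.Literature.Theta.LiuAlbaneseModuleDatum.D2Bridge (HcmPieces)

variable {L : HodgeCM.CMField} [IsGalois ℚ (L : Type)] {ι₁ : L →+* ℂ}
variable {V : HodgeCM.HermSpace3 L ι₁} {Φ : Literature.AlgebraicGeometry.Motives.CMType L} {isotropicAt : ℕ → Prop}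
variable (Char : Type) (Adm : Char → Type) (Ω : (i : Char) → Adm i → Type)
  [∀ i a, AddCommGroup (Ω i a)] [∀ i a, Module ℂ (Ω i a)] [∀ i a, Module (adelicAlgebra V) (Ω i a)]
  [∀ i a, IsScalarTower ℂ (adelicAlgebra V) (Ω i a)] (PhiMu : Char → Prop) (adm : Char → LiuCMSide → Prop)
variable {μ : Literature.NumberTheory.Automorphic.IdeleClassGroup L →ₜ* Circle}
  (hμ : Literature.NumberTheory.Automorphic.IdeleClassGroup.IsConjugateSymplectic L μ)
  (hw : Literature.NumberTheory.Automorphic.IdeleClassGroup.HasWeight L μ 1) (Car : Def45.Carriers L μ)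
  (Eps : Type) (epsOf : L → Eps) (Chi : Type) (omega : Eps → Chi → Type)
  [∀ ε χ, AddCommGroup (omega ε χ)] [∀ ε χ, Module ℂ (omega ε χ)]

set_option synthInstance.maxHeartbeats 400000 in
set_option maxHeartbeats 1600000 in
/-- **THE PIECES AT THE J-RECORD PIN** ([Liu2021] Thm. 4.18 (1), Rem. 4.17, Lem. 2.4 (1), Def. 4.5 (2) — the four sublemmas S1–S4 of the
CM-side contract, inhabited): for the J-record `M := map43RecordAtPin J …` over the one-object rest `HT.restOne …` (S2: prove-2), read into the
tower by `jHPin = id`, at every level `K ≤ Level.capThree K₀` and every index `i`, the structure `HcmPieces … (Tower …) (jHPin …) K.K (H¹(P_K;ℂ))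
(resTotal K) (T.cmClasses K i)` at `T := LiuDictionary.ofTower …` is inhabited — d2bridge-wb-3's datum-generic `nonempty_hcmPieces_ofTower_anyDatum` (prove-8's engine over any `P5`) fed with the S3∕S4
junction of §3 (`rj := (t_1 ≫ alb K₁ 1)^*`) and prove-1's S1 junction `exists_dLiu_of_objOne` at the record's OWN eigenvector `M.α`
(one `α` throughout, as printed, l. 2250).  Displayed inputs: the PRESENTATION EMBEDDING `ιg` of the one-object rest with `hinst : algebraMap L ℂ = ιg` (DECISION #13: the tower∕dictionary side stays at `ι₁`; `ιg := ι₁` or `ῑ₁` is the orientation audit's choice), `J ∕ hΓ`, `Dμ ∕ τ' ∕ hτ'`, `hK`, `hadmμ` (X3-Char, now from `ιg`-admissibility to the dictionary's `ι₁`-admissibility).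
[cite: Liu2021, Thm. 4.18 (1) (FJcycle.tex l. 2239), Rem. 4.17 (l. 2226–2228), proof of Thm. 4.18 map (4.2)/(4.3) (l. 2247–2253), Lem. 2.4 (1) (l. 1210–1228), Def. 4.5 (2) (l. 1944–1951), Prop. 4.6 (1) (l. 1969)] -/
theorem nonempty_hcmPieces_atJRecordPin {hHD : exists_isReal_hodgeModel} {hI : hodgePQ_independent_of_hodgeModel}
    {h₁ : BallQuotientUniformised} {h₃ : CMAbelianVarietyRealised} {hA : Arapura2012_Cor_15_4_6} {h : exists_recordSystem}
    {C : Sec42Data (Model.honestP5IdOf h ⟨L.K⟩ ι₁ ⟨V.Hm, V.isHermitian, V.signature_ι₁, V.posDef_of_ne⟩ Φ) isotropicAt}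
    {HT : C.HeckeTranslates}
    (rho : ∀ ε χ, Representation ℂ C.G (omega ε χ)) [Algebra (L : Type) ℂ] (ιg : (L : Type) →+* ℂ) (hinst : ∀ x : L, algebraMap (L : Type) ℂ x = ιg x)
    (J : ComponentAlbaneseId hHD hI (ballQuotientUniformisedDatum_of h₁) h₃ hA V h Φ C HT)
    (hΓ : ∀ K₁ : C5.SmallLevel C.S.K₀, ((J.Γof K₁).K : Subgroup ↥V.adelicFin) = (K₁.1 : Subgroup C.G))
    (Dμ : ObjOne (AlgHom.id ℚ (L : Type)) ιg hμ hw Car) (τ' : L →+* ℂ) (hτ' : τ' ∈ hμ.cmType.1) (i : Char) (K : HodgeCM.Level V)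
    (hK : K ≤ Level.capThree (V := V) (C.S.K₀.1 : Subgroup ↥V.adelicFin) C.S.K₀.2.1)
    (hadmμ : ∀ d : LiuCMSide, d.IsReflexOfTypeG ιg hμ.cmType → adm i d) :
    Nonempty (HcmPieces.{0, 1, 0} (toThm418Data C (HT.restOne (AlgHom.id ℚ (L : Type)) ιg hμ hw Car Eps epsOf Chi omega rho))
      (map43RecordAtPin J (AlgHom.id ℚ (L : Type)) ιg hμ hw Car Eps epsOf Chi omega rho Dμ τ' hτ')
      (Tower hHD hI (ballQuotientUniformisedDatum_of h₁) h₃ hA V)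
      (jHPin J (AlgHom.id ℚ (L : Type)) ιg hμ hw Car Eps epsOf Chi omega rho Dμ τ' hτ') K.K
      ((picardCMUniverse hHD hI h₁ h₃).CohC ((picardCMUniverse hHD hI h₁ h₃).pms L ι₁ V K) 1)
      (resTotal hHD hI (ballQuotientUniformisedDatum_of h₁) h₃ hA K)
      ((LiuDictionary.ofTower hHD hI h₁ h₃ hA V Char Adm Ω PhiMu adm).cmClasses K i)) := by
  have e : J.Γof (C.levelOf (K.K : Subgroup ↥V.adelicFin)) = K := J.Γof_levelOf_eq_of_K_eq hK hΓ
  have ht := J.transCond_one_of_Γof_eq e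
  -- S1: Liu's own datum as a ℚ-family of admissible model records carrying THE record's eigenvector (prove-1, ✔ `HcmS1PinJunction`)
  obtain ⟨dLiu, u, hadm, hu⟩ := exists_dLiu_of_objOne ιg hμ hw Car hinst Dμ
    (map43RecordAtPin J (AlgHom.id ℚ (L : Type)) ιg hμ hw Car Eps epsOf Chi omega rho Dμ τ' hτ').α
    (map43RecordAtPin J (AlgHom.id ℚ (L : Type)) ιg hμ hw Car Eps epsOf Chi omega rho Dμ τ' hτ').α_mem
    (map43RecordAtPin J (AlgHom.id ℚ (L : Type)) ιg hμ hw Car Eps epsOf Chi omega rho Dμ τ' hτ').α_ne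
  -- the engine: d2bridge-wb-3's DATUM-GENERIC ✔ `nonempty_hcmPieces_ofTower_anyDatum` (prove-8's `nonempty_hcmPieces_ofTower` over ANY `P5`), at `KK := K.K`
  exact nonempty_hcmPieces_ofTower_anyDatum V Char Adm Ω PhiMu adm C (AlgHom.id ℚ (L : Type)) ιg hμ hw Car Eps epsOf Chi omega rho
    (HT.rhoΩOne (AlgHom.id ℚ (L : Type)) ιg hμ hw Car)
    (map43RecordAtPin J (AlgHom.id ℚ (L : Type)) ιg hμ hw Car Eps epsOf Chi omega rho Dμ τ' hτ')
    (levelwisePin J (AlgHom.id ℚ (L : Type)) ιg hμ hw Car Dμ)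
    (map43RecordAtPin_P J (AlgHom.id ℚ (L : Type)) ιg hμ hw Car Eps epsOf Chi omega rho Dμ τ' hτ')
    (jHPin J (AlgHom.id ℚ (L : Type)) ιg hμ hw Car Eps epsOf Chi omega rho Dμ τ' hτ') i (K.K : Subgroup ↥V.adelicFin) K
    (BettiUniverse.pull
      (transMorU (ballQuotientUniformisedDatum_of h₁) h₃ hHD hI hA (1 : ↥(Urat V)).2 K
          ((J.Γof (C.levelOf (K.K : Subgroup ↥V.adelicFin))).conj 1 (J.belowConjThree _)) ht ≫
        J.alb (C.levelOf (K.K : Subgroup ↥V.adelicFin)) 1) 1)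
    (J.resTotal_ι_transKQ_tmul (AlgHom.id ℚ (L : Type)) ιg hμ hw Car Eps epsOf Chi omega rho Dμ τ' hτ' e ht)
    (map43RecordAtPin J (AlgHom.id ℚ (L : Type)) ιg hμ hw Car Eps epsOf Chi omega rho Dμ τ' hτ').α
    (fun f => transMorU (ballQuotientUniformisedDatum_of h₁) h₃ hHD hI hA (1 : ↥(Urat V)).2 K
          ((J.Γof (C.levelOf (K.K : Subgroup ↥V.adelicFin))).conj 1 (J.belowConjThree _)) ht ≫
        J.alb (C.levelOf (K.K : Subgroup ↥V.adelicFin)) 1 ≫ (AbelianVariety.Hom.baseChange ℂ f).hom.hom.hom)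
    (fun f => J.rj_comp_phiStarQ_baseChange (AlgHom.id ℚ (L : Type)) ιg hμ hw Car Dμ ht f _)
    dLiu u hu (fun q => hadmμ _ (hadm _ rfl q))

set_option synthInstance.maxHeartbeats 400000 in
set_option maxHeartbeats 3200000 in
/-- **THE PIECES AT THE LITERAL DECISION #8 TYPE** — the `pieces i hμ hg K hK` binder of `PinSignatures.thm418C_ofTower_of_pins` at
`tail := restTailOne …`, `M := map43RecordAtPin … U.Eps U.epsOf U.Chi (U.omega μ hμ) (U.rho μ hμ) …` (the BODY of `map43RecordAtUniformRest`; see the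
module docstring's spelling rule), `jH := jHPin …`: the previous theorem re-typed along `restOne_eq_rest` (rests of record `U.rest (restTailOne …)` for
μ-uniform Weil carriers `U : UniformOmega C`, [Liu2021] Def. 4.11 ∕ 4.16) and `ofTower_H` (`T.H = Tower …`), both `rfl`.
[cite: Liu2021, Thm. 4.18 (1) (FJcycle.tex l. 2239), proof of Thm. 4.18 (l. 2247–2253), Def. 4.11, Def. 4.16, Lem. 2.4 (1) (l. 1210–1228), Def. 4.5 (2) (l. 1944–1951)] -/
theorem nonempty_hcmPieces_atUniformRest {hHD : exists_isReal_hodgeModel} {hI : hodgePQ_independent_of_hodgeModel}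
    {h₁ : BallQuotientUniformised} {h₃ : CMAbelianVarietyRealised} {hA : Arapura2012_Cor_15_4_6} {h : exists_recordSystem}
    {C : Sec42Data (Model.honestP5IdOf h ⟨L.K⟩ ι₁ ⟨V.Hm, V.isHermitian, V.signature_ι₁, V.posDef_of_ne⟩ Φ) isotropicAt}
    {HT : C.HeckeTranslates}
    [Algebra (L : Type) ℂ] (ιg : (L : Type) →+* ℂ) (hinst : ∀ x : L, algebraMap (L : Type) ℂ x = ιg x) (U : UniformOmega C)
    (J : ComponentAlbaneseId hHD hI (ballQuotientUniformisedDatum_of h₁) h₃ hA V h Φ C HT)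
    (hΓ : ∀ K₁ : C5.SmallLevel C.S.K₀, ((J.Γof K₁).K : Subgroup ↥V.adelicFin) = (K₁.1 : Subgroup C.G))
    (Dμ : ObjOne (AlgHom.id ℚ (L : Type)) ιg hμ hw Car) (τ' : L →+* ℂ) (hτ' : τ' ∈ hμ.cmType.1) (i : Char) (K : HodgeCM.Level V)
    (hK : K ≤ Level.capThree (V := V) (C.S.K₀.1 : Subgroup ↥V.adelicFin) C.S.K₀.2.1)
    (hadmμ : ∀ d : LiuCMSide, d.IsReflexOfTypeG ιg hμ.cmType → adm i d) :
    Nonempty (HcmPieces.{0, 1, 0}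
      (toThm418Data C (U.rest (restTailOne (AlgHom.id ℚ (L : Type)) ιg hμ hw Car (HT.rhoΩOne (AlgHom.id ℚ (L : Type)) ιg hμ hw Car))))
      (map43RecordAtPin J (AlgHom.id ℚ (L : Type)) ιg hμ hw Car U.Eps U.epsOf U.Chi (U.omega μ hμ) (U.rho μ hμ) Dμ τ' hτ')
      (LiuDictionary.ofTower hHD hI h₁ h₃ hA V Char Adm Ω PhiMu adm).H
      (jHPin J (AlgHom.id ℚ (L : Type)) ιg hμ hw Car U.Eps U.epsOf U.Chi (U.omega μ hμ) (U.rho μ hμ) Dμ τ' hτ') K.K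
      ((picardCMUniverse hHD hI h₁ h₃).CohC ((picardCMUniverse hHD hI h₁ h₃).pms L ι₁ V K) 1)
      (resTotal hHD hI (ballQuotientUniformisedDatum_of h₁) h₃ hA K)
      ((LiuDictionary.ofTower hHD hI h₁ h₃ hA V Char Adm Ω PhiMu adm).cmClasses K i)) :=
  nonempty_hcmPieces_atJRecordPin Char Adm Ω PhiMu adm hμ hw Car U.Eps U.epsOf U.Chi (U.omega μ hμ) (U.rho μ hμ) ιg hinst J hΓ Dμ τ' hτ'
    i K hK hadmμ

set_option synthInstance.maxHeartbeats 400000 in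
set_option maxHeartbeats 3200000 in
/-- **THE PIECES AT THE LITERAL PIN `liuDictionaryPin hHD hI h₁ h₃ hA V I line`** — the `pieces i hμ hg K hK` binder of the landed pin-form
assembly `PinSignatures.thm418C_liuDictionaryPin_of_pins` at `U := U i hμ hg`, `tail := restTailOne …`, `M := map43RecordAtPin … U-fields …`,
`jH := jHPin …`: pure instantiation of the previous theorem at `Char := I`, `Adm i := {χ // (line i).IsAutChar χ}`, `Ω i a := (line i).Ω (ιVE V) a.1`,
`PhiMu i := SplitLine.PhiMuLine ι₁ (line i)`, `adm i dd := dd.IsReflexOfTypeG ι₁ (SplitLine.typeOfLine (line i))` (`liuDictionaryPin_eq`, `rfl`);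
X3-Char is now LITERALLY `hadmμ : d.IsReflexOfTypeG ι₁ Φ_μ → d.IsReflexOfTypeG ι₁ (typeOfLine (line i))`.
[cite: Liu2021, Thm. 4.18 (1) (FJcycle.tex l. 2239), proof of Thm. 4.18 (l. 2247–2253), Lem. 2.4 (1) (l. 1210–1228), Def. 4.3 (2) (l. 1919), Def. 4.5 (2) (l. 1944–1951)] -/
theorem nonempty_hcmPieces_atLiuDictionaryPin {hHD : exists_isReal_hodgeModel} {hI : hodgePQ_independent_of_hodgeModel}
    {h₁ : BallQuotientUniformised} {h₃ : CMAbelianVarietyRealised} {hA : Arapura2012_Cor_15_4_6} {h : exists_recordSystem}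
    {C : Sec42Data (Model.honestP5IdOf h ⟨L.K⟩ ι₁ ⟨V.Hm, V.isHermitian, V.signature_ι₁, V.posDef_of_ne⟩ Φ) isotropicAt}
    {HT : C.HeckeTranslates}
    [Algebra (L : Type) ℂ] (ιg : (L : Type) →+* ℂ) (hinst : ∀ x : L, algebraMap (L : Type) ℂ x = ιg x)
    (I : Type) (line : I → HodgeCM.Model.SplitLineE V) (U : UniformOmega C)
    (J : ComponentAlbaneseId hHD hI (ballQuotientUniformisedDatum_of h₁) h₃ hA V h Φ C HT)
    (hΓ : ∀ K₁ : C5.SmallLevel C.S.K₀, ((J.Γof K₁).K : Subgroup ↥V.adelicFin) = (K₁.1 : Subgroup C.G))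
    (Dμ : ObjOne (AlgHom.id ℚ (L : Type)) ιg hμ hw Car) (τ' : L →+* ℂ) (hτ' : τ' ∈ hμ.cmType.1) (i : I) (K : HodgeCM.Level V)
    (hK : K ≤ Level.capThree (V := V) (C.S.K₀.1 : Subgroup ↥V.adelicFin) C.S.K₀.2.1)
    (hadmμ : ∀ d : LiuCMSide, d.IsReflexOfTypeG ιg hμ.cmType → d.IsReflexOfTypeG ι₁ (HodgeCM.Model.SplitLine.typeOfLine (line i))) :
    Nonempty (HcmPieces.{0, 1, 0}
      (toThm418Data C (U.rest (restTailOne (AlgHom.id ℚ (L : Type)) ιg hμ hw Car (HT.rhoΩOne (AlgHom.id ℚ (L : Type)) ιg hμ hw Car))))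
      (map43RecordAtPin J (AlgHom.id ℚ (L : Type)) ιg hμ hw Car U.Eps U.epsOf U.Chi (U.omega μ hμ) (U.rho μ hμ) Dμ τ' hτ')
      (HodgeCM.Model.liuDictionaryPin hHD hI h₁ h₃ hA V I line).H
      (jHPin J (AlgHom.id ℚ (L : Type)) ιg hμ hw Car U.Eps U.epsOf U.Chi (U.omega μ hμ) (U.rho μ hμ) Dμ τ' hτ') K.K
      ((picardCMUniverse hHD hI h₁ h₃).CohC ((picardCMUniverse hHD hI h₁ h₃).pms L ι₁ V K) 1)
      (resTotal hHD hI (ballQuotientUniformisedDatum_of h₁) h₃ hA K)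
      ((HodgeCM.Model.liuDictionaryPin hHD hI h₁ h₃ hA V I line).cmClasses K i)) :=
  nonempty_hcmPieces_atUniformRest I (fun i => {χ : (line i).CharW // (line i).IsAutChar χ})
    (fun i a => (line i).Ω (HodgeCM.Model.ιVE V) a.1) (fun i => HodgeCM.Model.SplitLine.PhiMuLine ι₁ (line i))
    (fun i dd => dd.IsReflexOfTypeG ι₁ (HodgeCM.Model.SplitLine.typeOfLine (line i))) hμ hw Car ιg hinst U J hΓ Dμ τ' hτ' i K hK hadmμ

end Compositions

/-! ## §5  Instance = tail = key = ι₁: the X3-Char input discharged from the T-SIGN identity -/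

section AtIotaOne

open HodgeCM.Literature.Theta.LiuAlbaneseModuleDatum.D2Bridge (HcmPieces)

variable {L : HodgeCM.CMField} [IsGalois ℚ (L : Type)] {ι₁ : L →+* ℂ}
variable {V : HodgeCM.HermSpace3 L ι₁} {Φ : Literature.AlgebraicGeometry.Motives.CMType L} {isotropicAt : ℕ → Prop}
variable {μ : Literature.NumberTheory.Automorphic.IdeleClassGroup L →ₜ* Circle}
  (hμ : Literature.NumberTheory.Automorphic.IdeleClassGroup.IsConjugateSymplectic L μ)
  (hw : Literature.NumberTheory.Automorphic.IdeleClassGroup.HasWeight L μ 1) (Car : Def45.Carriers L μ)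

set_option synthInstance.maxHeartbeats 400000 in
set_option maxHeartbeats 3200000 in
/-- **THE PIECES AT THE LITERAL PIN OVER THE UNTWISTED DATUM, instance `ι₁`, X3-Char DISCHARGED**: §4's `nonempty_hcmPieces_atLiuDictionaryPin`
at `ιg := ι₁` (the instance of pin-a's cofan along `ι₁` and its `J : ComponentAlbaneseId`), `hadmμ := fun _ hd => hsign ▸ hd` from the T-SIGN
identity `hsign : Φ_μ = typeOfLine (line i)` (✔ `OmegaPinTSign` ∕ `cmType_eq_lineType_of_deltaPos`) — S1's output `IsReflexOfTypeG ι₁ Φ_μ` IS `adm i`.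
[cite: Liu2021, Thm. 4.18 (1) (FJcycle.tex l. 2239), proof of Thm. 4.18 (l. 2247–2253: «fix τ′ ∈ Φ_μ»), Def. 4.3 (2) (l. 1919), Def. 4.5 (2) (l. 1944–1951), Def. 4.12 (l. 2105–2109)] -/
theorem nonempty_hcmPieces_atLiuDictionaryPin_of_cmType_eq {hHD : exists_isReal_hodgeModel} {hI : hodgePQ_independent_of_hodgeModel}
    {h₁ : BallQuotientUniformised} {h₃ : CMAbelianVarietyRealised} {hA : Arapura2012_Cor_15_4_6} {h : exists_recordSystem}
    {C : Sec42Data (Model.honestP5IdOf h ⟨L.K⟩ ι₁ ⟨V.Hm, V.isHermitian, V.signature_ι₁, V.posDef_of_ne⟩ Φ) isotropicAt}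
    {HT : C.HeckeTranslates}
    [Algebra (L : Type) ℂ] (hinst : ∀ x : L, algebraMap (L : Type) ℂ x = ι₁ x)
    (I : Type) (line : I → HodgeCM.Model.SplitLineE V) (U : UniformOmega C)
    (J : ComponentAlbaneseId hHD hI (ballQuotientUniformisedDatum_of h₁) h₃ hA V h Φ C HT)
    (hΓ : ∀ K₁ : C5.SmallLevel C.S.K₀, ((J.Γof K₁).K : Subgroup ↥V.adelicFin) = (K₁.1 : Subgroup C.G))
    (Dμ : ObjOne (AlgHom.id ℚ (L : Type)) ι₁ hμ hw Car) (τ' : L →+* ℂ) (hτ' : τ' ∈ hμ.cmType.1) (i : I) (K : HodgeCM.Level V)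
    (hK : K ≤ Level.capThree (V := V) (C.S.K₀.1 : Subgroup ↥V.adelicFin) C.S.K₀.2.1)
    (hsign : hμ.cmType = HodgeCM.Model.SplitLine.typeOfLine (line i)) :
    Nonempty (HcmPieces.{0, 1, 0}
      (toThm418Data C (U.rest (restTailOne (AlgHom.id ℚ (L : Type)) ι₁ hμ hw Car (HT.rhoΩOne (AlgHom.id ℚ (L : Type)) ι₁ hμ hw Car))))
      (map43RecordAtPin J (AlgHom.id ℚ (L : Type)) ι₁ hμ hw Car U.Eps U.epsOf U.Chi (U.omega μ hμ) (U.rho μ hμ) Dμ τ' hτ')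
      (HodgeCM.Model.liuDictionaryPin hHD hI h₁ h₃ hA V I line).H
      (jHPin J (AlgHom.id ℚ (L : Type)) ι₁ hμ hw Car U.Eps U.epsOf U.Chi (U.omega μ hμ) (U.rho μ hμ) Dμ τ' hτ') K.K
      ((picardCMUniverse hHD hI h₁ h₃).CohC ((picardCMUniverse hHD hI h₁ h₃).pms L ι₁ V K) 1)
      (resTotal hHD hI (ballQuotientUniformisedDatum_of h₁) h₃ hA K)
      ((HodgeCM.Model.liuDictionaryPin hHD hI h₁ h₃ hA V I line).cmClasses K i)) :=
  nonempty_hcmPieces_atLiuDictionaryPin hμ hw Car ι₁ hinst I line U J hΓ Dμ τ' hτ' i K hK fun _ hd => hsign ▸ hd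

end AtIotaOne

end Summit.HodgeConjecture.CorCM.D2Bridge.Iota1

end
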